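import Summits.BirchSwinnertonDyer.BirchSwinnertonDyer.Theses.SignedBaseChange
import Summits.BirchSwinnertonDyer.BirchSwinnertonDyer.Theorems.SignedBaseChangeTwistPairGreenbergProductDivisibilityStubFrameDataBCSSplit
import Summits.BirchSwinnertonDyer.BirchSwinnertonDyer.Theorems.SignedBaseChangeK2RFrames
import Summits.BirchSwinnertonDyer.Rank1Residual.Additive.QuadraticTwistSurj
import Literature.NumberTheory.IwasawaTheory.IwasawaAlgebraTwoVarRegularProofs
import HarnessLib

/-! # Skeleton line `acanchor` ("anticyclotomic anchor + deformation rigidity") for crux K1′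
`TwistPairGreenbergProductDivisibilitySplit` (stmt-BirchSwinnertonDyer-20502), route SignedBaseChange —
crux-strategist `cstrat-stmt-BirchSwinnertonDyer-20502` g0 (2026-08-27).

THE MOVE. The registered line `birth` (v1–v6) put the whole open content of K1′ into ONE stub, the
two-variable EISENSTEIN divisibility `ch(X_Gr)·ch(X_Gr') ⊆ (s·G·G')` ("Theorem A": semi-ordinary
Klingen–Eisenstein family on GU(3,1) over the real quadratic `F = ℚ(√d)`), and died three times on the same
two gaps (G1: Hida/Klingen theory on GU(3,1)/F unprinted; G2: local triple products at additive primes).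
This line never touches an Eisenstein series in two variables and never leaves `ℚ`/`K`: PER FACTOR
(`E/K` and `E^{(d)}/K` separately — both satisfy the classical Heegner hypothesis for the package's `K`),
  (ES)  the two-variable EULER-SYSTEM divisibility `(G) ⊆ ch(X_Gr(E/K_∞))·𝒪⟦T₁,T₂⟧` (Beilinson–Flach
        classes along the CM Hida family of `K`, signed Coleman maps at the supersingular `p`) —
        `stub_eulerSystemDivisibility`;
  (AC)  the ANTICYCLOTOMIC ANCHOR: on the line `T₁ = 0` (`γ⁺ ↦ 1`, the tree's `UnrSeries₂.minus`) the image
        of the two-variable characteristic ideal lies in `(G⁻)` and `G⁻ ≠ 0` — the Eisenstein direction of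
        the BDP/Greenberg anticyclotomic main conjecture under classical Heegner at a supersingular prime
        (± Heegner-point Kolyvagin system + its Λ-primitivity + BDP explicit reciprocity + control `T₁ → 0`
        + Hsieh's non-vanishing) — `stub_anticyclotomicAnchor` (the load-bearing stub);
(two registered stubs; principality of characteristic ideals over `Λ_K = ℤ_p⟦T₁⟧⟦T₂⟧` is PROVED here —
`charIdealIsPrincipal₂`, from the tree's `uniqueFactorizationMonoid_powerSeries_powerSeries`; surjectivity of `ρ̄_{E^{(d)},p}` is IN-TREE: `Rank1Residual.Additive.surj_iff_of_model_twist`)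
and then a PROVED deformation-rigidity lemma (`le_span_of_anchor`): if `I = (c)` is principal, `G ∈ I`,
`I|_{T₁=0} ⊆ (G|_{T₁=0})` and `G|_{T₁=0} ≠ 0`, then `G = c·h` with `h(0,T₂)` a unit of `𝒪⟦T₂⟧`, hence `h`
a unit of `𝒪⟦T₁⟧⟦T₂⟧` and `I = (G)`. So each factor satisfies `ch ⊆ (G)` INTEGRALLY (slack `s = 1`), and
K1′'s product clause follows by `Ideal.mul_mono`; the `∃`-half of K1′ (the field/twist package, incl. Heegner
splitting for `N`, `2` and the primes of `d`) is the LANDED `stub_frameDataBCSsplit` (p525981); Heegner for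
the twist conductor `N'`, good reduction of the twist at `p` and `(N', D_K) = 1` are proved here from the
landed K2R lemmas. The cyclotomic line is never used (anchoring there = Kobayashi's IMC for X7 = the
route's target leaf: circular); the anticyclotomic line is where the ordinary analogue is a THEOREM for every
conductor (Yan–Zhu 2026 Thm. 5.7 (1)), and where additive primes are invisible (`c_ℓ ≤ 4 < p`).

`lean check`: sorries ONLY in the two `stub_*`; `TwistPairGreenbergProductDivisibilitySplit_of` concludes the
crux BY NAME. Card: `Lines/acanchor.md`. -/

-- D-0017: single-problem summit, namespace repeats the problem name by design.
set_option linter.dupNamespace false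
set_option autoImplicit false

namespace Summit.BirchSwinnertonDyer.BirchSwinnertonDyer.Cruxes.TwistPairGreenbergProductDivisibilitySplit.Acanchor

open Summit.BirchSwinnertonDyer.BirchSwinnertonDyer.Theses.SignedBaseChange
open Literature.NumberTheory.EllipticCurves Literature.NumberTheory.EllipticCurves.ModularForms
  Literature.NumberTheory.EllipticCurves.BurungaleSkinnerTianWan2024
  Literature.NumberTheory.GaloisRepresentations

/-! ## The two registered stubs (and the proved principality lemma) -/

/-- (UFD — PROVED, no longer a stub) **principality of characteristic ideals over
`Λ_K = ℤ_p⟦T₁⟧⟦T₂⟧`.** The tree's `Module.charIdeal` is a `finprod` of powers of height-one primes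
(junk value `1`); `IwasawaAlgebra₂ p = (ℤ_[p]⟦T⟧)⟦T⟧` is factorial by the tree's
`Literature.NumberTheory.IwasawaTheory.uniqueFactorizationMonoid_powerSeries_powerSeries` (regular local of
dimension `3` ⇒ UFD, Auslander–Buchsbaum / Matsumura Thm. 20.3), and height-one primes of a UFD are
principal — verbatim the one-variable proof `charIdeal_isPrincipal_holds` (`IwasawaAlgebra.lean`).
Rigidity genuinely needs it: for the non-principal `I = (G, T₁·h)` every other hypothesis of
`le_span_of_anchor` holds and the conclusion fails. -/
theorem charIdealIsPrincipal₂ (p : ℕ) [Fact p.Prime] (M : Type) [AddCommGroup M]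
    [Module (IwasawaAlgebra₂ p) M] :
    (Literature.NumberTheory.EllipticCurves.Module.charIdeal (IwasawaAlgebra₂ p) M).IsPrincipal := by
  haveI : UniqueFactorizationMonoid (IwasawaAlgebra₂ p) :=
    Literature.NumberTheory.IwasawaTheory.uniqueFactorizationMonoid_powerSeries_powerSeries ℤ_[p]
  unfold Module.charIdeal
  rw [← Ideal.mem_isPrincipalSubmonoid_iff]
  refine finprod_mem_induction (· ∈ Ideal.isPrincipalSubmonoid (IwasawaAlgebra₂ p))
    (Submonoid.one_mem _) (fun _ _ hx hy => Submonoid.mul_mem _ hx hy) ?_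
  intro 𝔭 h𝔭
  refine Submonoid.pow_mem _ ?_ _
  obtain ⟨g, hg⟩ := UniqueFactorizationMonoid.isPrincipal_of_height_eq_one h𝔭
  rw [hg]
  exact Ideal.span_singleton_mem_isPrincipalSubmonoid g

/-- stub (ES): **two-variable Euler-system divisibility for `X_Gr(E/K_∞)` at a good prime `p ≥ 5`,
classical Heegner `K`, `p` split, `ρ̄_{E,p}` surjective — INTEGRAL, in K1′'s receptacle:** for every
Katz/Greenberg frame `(LK, G)` and structure map `J`, `(G) ⊆ ch_{Λ_K}(X_Gr(E/K_∞))·𝒪_{ℂ_p}⟦T₁⟧⟦T₂⟧`.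
Mechanism: Beilinson–Flach classes along the CM Hida family of `K` (Lei–Loeffler–Zerbes, Kings–Loeffler–
Zerbes; Loeffler–Zerbes in Coleman families), their signed (`#/♭`, here `±` since `a_p = 0` for `p ≥ 5`)
decomposition and the locally-restricted Euler/Kolyvagin-system bound over `Λ_K` (Büyükboduk–Lei
arXiv:1605.05310 Thms 1.2, §4.4; Castella–Çiperiani–Skinner–Sprung arXiv:1804.10993 §3 and Thm. 3.7 for the
passage signed ⟷ Greenberg `(rel, str)` by two-variable explicit reciprocity + Poitou–Tate; BSTW
arXiv:2409.01350 Prop. 9.18; ordinary twin: Yan–Zhu 2026 Cor. 2.9 from Kato). Reduction-type-free as stated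
(at ordinary `p` it is the Kato/BF divisibility); additive primes of `N` enter only through finite local
terms with Tamagawa numbers `≤ 4`, prime to `p ≥ 5`. Why it might fail: print is "⊗ ℚ_p / up to exceptional
primes" or assumes square-free `N` as a blanket hypothesis; integrality needs the big-image argument for
`T_f ⊗ (CM family)`; Büyükboduk–Lei twist by a `p`-distinguished character. -/
theorem stub_eulerSystemDivisibility :
    Literature.NumberTheory.EllipticCurves.ModularForms.nonempty_modularParametrizationData →
    ∀ (W : WeierstrassCurve ℚ) [W.IsElliptic] [W.IsGloballyMinimal] (p : ℕ) [Fact p.Prime], 5 ≤ p →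
    W.HasGoodReductionAtPrime p → Literature.NumberTheory.EllipticCurves.Rank1Residual.Surj W p →
    ∀ (K : Type) [Field K] [NumberField K] (ι : PadicAlgCl p ≃+* ℂ)
      (v vbar : IsDedekindDomain.HeightOneSpectrum (NumberField.RingOfIntegers K))
      (κ₁ κ₂ : ZpExtension K p) (γ₁ γ₂ : Field.absoluteGaloisGroup K)
      [Fact (ZpExtension.IsTopGeneratorPair κ₁ κ₂ γ₁ γ₂)] [NeZero (NumberField.discr K).natAbs]
      (N : ℕ) [NeZero N] (f : CuspForm (CongruenceSubgroup.Gamma0 N) 2),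
    IsNewformOf W f → (N : ℤ) = W.conductorNorm ℤ → IsImaginaryQuadratic K →
    ((Ideal.span {(p : ℤ)}).primesOver (NumberField.RingOfIntegers K)).ncard = 2 →
    ((p : ℕ) : NumberField.RingOfIntegers K) ∈ v.asIdeal →
    ((p : ℕ) : NumberField.RingOfIntegers K) ∈ vbar.asIdeal → vbar ≠ v →
    (∀ (w : NumberField.InfinitePlace K) (k : NumberField.RingOfIntegers K),
      k ∈ v.asIdeal ↔ ‖ι.symm (w.embedding (k : K))‖ < 1) →
    IsCoprime (N : ℤ) (NumberField.discr K) →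
    (∀ ℓ : ℕ, ℓ.Prime → ℓ ∣ N → ((Ideal.span {(ℓ : ℤ)}).primesOver (NumberField.RingOfIntegers K)).ncard = 2) →
    Odd (NumberField.discr K) → NumberField.discr K ≠ -3 →
    κ₁.IsCyclotomic → κ₂.IsAnticyclotomic →
    ∀ (Ω δ : ℂ) (Ωp : (unrIntegers p)ˣ) (LK G : PowerSeries (PowerSeries (PadicComplexInt p))),
      Ω ≠ 0 → (δ ^ 2 = (NumberField.discr K : ℂ) ∨ δ ^ 2 = -(NumberField.discr K : ℂ)) →
      IsKatzMeasure₂ ι v vbar ∅ κ₁ κ₂ γ₁⁻¹ γ₂⁻¹ 1 Ω δ ((Ωp : unrIntegers p) : PadicComplex p) LK →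
      IsGreenbergLFunctionAnyRoot₂ ι v vbar κ₁ κ₂ γ₁⁻¹ γ₂⁻¹ f (NumberField.discr K).natAbs
        (NumberField.classNumber K) LK G →
      ∀ J : ℤ_[p] →+* PadicComplexInt p,
        (∀ x : ℤ_[p], ((J x : PadicComplexInt p) : PadicComplex p) = ((x : ℚ_[p]) : PadicComplex p)) →
        Ideal.span {G} ≤
          (WeierstrassCurve.XGr₂.charIdeal (W.baseChange K) p κ₁ κ₂ vbar γ₁ γ₂).map (IwasawaAlgebra₂.toUnr₂ p J) := by
  sorry

/-- stub (AC) — LOAD-BEARING: **the anticyclotomic anchor.** Same data as (ES); conclusion on the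
anticyclotomic line `T₁ = 0` (`γ⁺ ↦ 1`; `UnrSeries₂.minus = PowerSeries.constantCoeff`, (T1) of
`YanZhu2026/GreenbergMainTheorems`): `G⁻ ≠ 0`, and the image of `ch_{Λ_K}(X_Gr(E/K_∞))·𝒪⟦T₁,T₂⟧` under
`T₁ ↦ 0` lies in `(G⁻)`. Content = the EISENSTEIN direction of the anticyclotomic Greenberg/BDP main
conjecture for `E/K` (classical Heegner, `p ≥ 5` supersingular split) composed with control `T₁ → 0`
(no non-zero pseudo-null submodule of `X_Gr`, Tamagawa numbers at additive primes prime to `p`) and the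
comparison `(G⁻) = (𝓛_p^BDP(E/K))·unit` (Castella–Grossi–Skinner Prop. 2.4.5 = BCS 2025 (3.14), any root),
plus `G⁻ ≠ 0` (Hsieh 2014 Thm. B: `μ(𝓛^BDP) = 0`; tree: named fact
`BurungaleCastellaSkinner2025.prop422_grHalf_hasUnitContent_minus`). ORDINARY TWIN = THEOREM for every
conductor: Yan–Zhu, J. Algebra 693 (2026) Thm. 5.7 (1) (tree: `YanZhu2026.thm57_isTorsion_charIdealXGr_eq_
bdpLFunction`). At supersingular `p` the Euler-system half is printed (± Heegner Kolyvagin system: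
Castella–Wan arXiv:1607.02019, Longo–Vigni, CÇSS arXiv:1804.10993 Thm. 5.7; BDP explicit reciprocity
`Log(z^±) = 𝓛^BDP`: CW16 / CÇSS Thm. 4.x); the Eisenstein half = Λ-PRIMITIVITY of that Kolyvagin system
(⟸ Kolyvagin's conjecture mod `p` for `(E, K, p)`), proved in print only through a RANK-0 CONVERSE for
level-raised congruent forms `g ≡ f`: Sweeting arXiv:2012.11771 Thm. 1.1 ⟸ Thm. 10.2 (Kato + Skinner–Urban /
Wan), which at supersingular `p` needs `∃ ℓ ∥ N` (also for Ribet–Takahashi/Khare, p. 5) and, through Wan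
arXiv:1411.6352 Thm. 1.3, square-free `N` ("can be removed if we would like to do some technical triple
product computations", loc. cit. p. 4). KERNEL G2″ = that rank-0 converse (equivalently Wan's `±` main
conjecture at the trivial character) for finitely many level-raised `g` of level `N·m` over `K`, additive
primes of `N` allowed, no multiplicative prime required. Why it might fail: G2″ is open; every printed
Eisenstein-direction input at a non-ordinary prime assumes square-free level; a W of analytic rank `≥ 2` is
in scope (K1′ has no rank hypothesis) — handled in print only by the same level-raising detour. -/
theorem stub_anticyclotomicAnchor :
    Literature.NumberTheory.EllipticCurves.ModularForms.nonempty_modularParametrizationData →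
    ∀ (W : WeierstrassCurve ℚ) [W.IsElliptic] [W.IsGloballyMinimal] (p : ℕ) [Fact p.Prime], 5 ≤ p →
    W.HasGoodReductionAtPrime p → Literature.NumberTheory.EllipticCurves.Rank1Residual.Surj W p →
    ∀ (K : Type) [Field K] [NumberField K] (ι : PadicAlgCl p ≃+* ℂ)
      (v vbar : IsDedekindDomain.HeightOneSpectrum (NumberField.RingOfIntegers K))
      (κ₁ κ₂ : ZpExtension K p) (γ₁ γ₂ : Field.absoluteGaloisGroup K)
      [Fact (ZpExtension.IsTopGeneratorPair κ₁ κ₂ γ₁ γ₂)] [NeZero (NumberField.discr K).natAbs]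
      (N : ℕ) [NeZero N] (f : CuspForm (CongruenceSubgroup.Gamma0 N) 2),
    IsNewformOf W f → (N : ℤ) = W.conductorNorm ℤ → IsImaginaryQuadratic K →
    ((Ideal.span {(p : ℤ)}).primesOver (NumberField.RingOfIntegers K)).ncard = 2 →
    ((p : ℕ) : NumberField.RingOfIntegers K) ∈ v.asIdeal →
    ((p : ℕ) : NumberField.RingOfIntegers K) ∈ vbar.asIdeal → vbar ≠ v →
    (∀ (w : NumberField.InfinitePlace K) (k : NumberField.RingOfIntegers K),
      k ∈ v.asIdeal ↔ ‖ι.symm (w.embedding (k : K))‖ < 1) →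
    IsCoprime (N : ℤ) (NumberField.discr K) →
    (∀ ℓ : ℕ, ℓ.Prime → ℓ ∣ N → ((Ideal.span {(ℓ : ℤ)}).primesOver (NumberField.RingOfIntegers K)).ncard = 2) →
    Odd (NumberField.discr K) → NumberField.discr K ≠ -3 →
    κ₁.IsCyclotomic → κ₂.IsAnticyclotomic →
    ∀ (Ω δ : ℂ) (Ωp : (unrIntegers p)ˣ) (LK G : PowerSeries (PowerSeries (PadicComplexInt p))),
      Ω ≠ 0 → (δ ^ 2 = (NumberField.discr K : ℂ) ∨ δ ^ 2 = -(NumberField.discr K : ℂ)) →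
      IsKatzMeasure₂ ι v vbar ∅ κ₁ κ₂ γ₁⁻¹ γ₂⁻¹ 1 Ω δ ((Ωp : unrIntegers p) : PadicComplex p) LK →
      IsGreenbergLFunctionAnyRoot₂ ι v vbar κ₁ κ₂ γ₁⁻¹ γ₂⁻¹ f (NumberField.discr K).natAbs
        (NumberField.classNumber K) LK G →
      ∀ J : ℤ_[p] →+* PadicComplexInt p,
        (∀ x : ℤ_[p], ((J x : PadicComplexInt p) : PadicComplex p) = ((x : ℚ_[p]) : PadicComplex p)) →
        UnrSeries₂.minus G ≠ 0 ∧
          ((WeierstrassCurve.XGr₂.charIdeal (W.baseChange K) p κ₁ κ₂ vbar γ₁ γ₂).map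
              (IwasawaAlgebra₂.toUnr₂ p J)).map
            (PowerSeries.constantCoeff (R := PowerSeries (PadicComplexInt p))) ≤
          Ideal.span {UnrSeries₂.minus G} := by
  sorry

/-! ## Proved glue I: deformation rigidity off the anticyclotomic line -/

/-- **Rigidity.** Over a domain `R`, in `R⟦T₂⟧⟦T₁⟧ = PowerSeries (PowerSeries R)` (outer variable `T₁`):
if `I = (c)` is principal, `G ∈ I`, the image of `I` under `T₁ ↦ 0` lies in `(G(0,·))` and `G(0,·) ≠ 0`,
then `I ⊆ (G)` (indeed `I = (G)`): `G = c·h`, `c(0,·) = G(0,·)·m` forces `m·h(0,·) = 1`, so `h` is a unit. -/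
theorem le_span_of_anchor {R : Type*} [CommRing R] [IsDomain R]
    {I : Ideal (PowerSeries (PowerSeries R))} {G : PowerSeries (PowerSeries R)}
    (hI : I.IsPrincipal) (hG : G ∈ I)
    (hanch : I.map (PowerSeries.constantCoeff (R := PowerSeries R)) ≤
      Ideal.span {PowerSeries.constantCoeff (R := PowerSeries R) G})
    (hne : PowerSeries.constantCoeff (R := PowerSeries R) G ≠ 0) :
    I ≤ Ideal.span {G} := by
  obtain ⟨⟨c, hc⟩⟩ := hI
  have hc' : I = Ideal.span {c} := hc
  subst hc'
  obtain ⟨h, hGh⟩ := Ideal.mem_span_singleton.mp hG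
  subst hGh
  have hcm : PowerSeries.constantCoeff (R := PowerSeries R) c ∈
      Ideal.span {PowerSeries.constantCoeff (R := PowerSeries R) (c * h)} :=
    hanch (Ideal.mem_map_of_mem _ (Ideal.mem_span_singleton_self c))
  obtain ⟨m, hm⟩ := Ideal.mem_span_singleton.mp hcm
  rw [map_mul] at hm hne
  have hc0 : PowerSeries.constantCoeff (R := PowerSeries R) c ≠ 0 := left_ne_zero_of_mul hne
  have h1 : PowerSeries.constantCoeff (R := PowerSeries R) h * m = 1 :=
    mul_left_cancel₀ hc0 (by rw [← mul_assoc, ← hm, mul_one])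
  have hu : IsUnit h := PowerSeries.isUnit_iff_constantCoeff.mpr (IsUnit.of_mul_eq_one m h1)
  exact Ideal.span_singleton_le_span_singleton.mpr ⟨↑hu.unit⁻¹, by rw [mul_assoc, IsUnit.mul_val_inv, mul_one]⟩

/-- **Rigidity in K1′'s receptacle.** For a principal ideal `I ⊆ Λ_K` and a structure map `J`: the
Euler-system inclusion `(G) ⊆ I·𝒪⟦T₁,T₂⟧`, the anticyclotomic anchor `(I·𝒪⟦T₁,T₂⟧)|_{T₁=0} ⊆ (G⁻)` and
`G⁻ ≠ 0` give the integral Eisenstein inclusion `I·𝒪⟦T₁,T₂⟧ ⊆ (G)`. -/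
theorem map_le_span_of_anchor {p : ℕ} [Fact p.Prime] {I : Ideal (IwasawaAlgebra₂ p)} (hI : I.IsPrincipal)
    (J : ℤ_[p] →+* PadicComplexInt p) {G : PowerSeries (PowerSeries (PadicComplexInt p))}
    (hES : Ideal.span {G} ≤ I.map (IwasawaAlgebra₂.toUnr₂ p J))
    (hanch : UnrSeries₂.minus G ≠ 0 ∧
      (I.map (IwasawaAlgebra₂.toUnr₂ p J)).map
          (PowerSeries.constantCoeff (R := PowerSeries (PadicComplexInt p))) ≤
        Ideal.span {UnrSeries₂.minus G}) :
    I.map (IwasawaAlgebra₂.toUnr₂ p J) ≤ Ideal.span {G} := by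
  have hP : (I.map (IwasawaAlgebra₂.toUnr₂ p J)).IsPrincipal := by
    obtain ⟨⟨c, hc⟩⟩ := hI
    have hc' : I = Ideal.span {c} := hc
    refine ⟨⟨IwasawaAlgebra₂.toUnr₂ p J c, ?_⟩⟩
    rw [hc', Ideal.map_span, Set.image_singleton]
  exact le_span_of_anchor hP (hES (Ideal.mem_span_singleton_self G)) hanch.2 hanch.1

/-- The product step with slack `s = 1`: `(C(1))·(A·B) ⊆ (G·G')` from `A ⊆ (G)`, `B ⊆ (G')`. -/
theorem span_C_one_mul_mul_le {p : ℕ} [Fact p.Prime]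
    {A B : Ideal (PowerSeries (PowerSeries (PadicComplexInt p)))}
    {G G' : PowerSeries (PowerSeries (PadicComplexInt p))}
    (hA : A ≤ Ideal.span {G}) (hB : B ≤ Ideal.span {G'}) :
    Ideal.span {PowerSeries.map (PowerSeries.C (R := PadicComplexInt p)) 1} * (A * B) ≤
      Ideal.span {G * G'} := by
  rw [map_one, Ideal.span_singleton_one, Ideal.top_mul, ← Ideal.span_singleton_mul_span_singleton]
  exact Ideal.mul_mono hA hB

/-! ## Proved glue II: the twist `W'` of the package inherits the per-factor hypotheses -/

/-- **Surjectivity of `ρ̄_{E,p}` passes to the twist `W'` of the package** — IN-TREE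
(`Summit.BirchSwinnertonDyer.Rank1Residual.Additive.surj_iff_of_model_twist`: the twisting isomorphism is
`χ_d`-signed-equivariant; model independence `hasSurjectiveModNGaloisRep_smul_iff`). -/
theorem surj_of_smul_eq_quadraticTwist (W W' : WeierstrassCurve ℚ) [W.IsElliptic] [W'.IsElliptic]
    (p : ℕ) [Fact p.Prime] {d : ℤ} {C : WeierstrassCurve.VariableChange ℚ} (hd : 1 < d)
    (hC : C • W' = W.quadraticTwist (d : ℚ))
    (hs : Literature.NumberTheory.EllipticCurves.Rank1Residual.Surj W p) :
    Literature.NumberTheory.EllipticCurves.Rank1Residual.Surj W' p := by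
  have hd0 : (d : ℚ) ≠ 0 := by exact_mod_cast (show d ≠ 0 by omega)
  exact (Summit.BirchSwinnertonDyer.Rank1Residual.Additive.surj_iff_of_model_twist W p hd0
    ⟨C⁻¹, by rw [← hC, inv_smul_smul]⟩).mpr hs

/-- **Heegner for the twist conductor.** If `C • W' = W^{(d)}`, every prime of `N = N_W` splits in `K`,
every prime of `d` splits in `K` and `2` splits in `K`, then every prime of `N' = N_{W'}` splits in `K`:
a prime `ℓ ∣ N'` is bad for `W'`, hence either ramified in `ℚ(√d)` (`ℓ ∣ d` or `ℓ = 2`) or bad for `W`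
(`hasGoodReductionAtPrime_of_smul_eq_quadraticTwist_of_not_ramifiedInQuadratic`, K2R). -/
theorem heegner_twist (W W' : WeierstrassCurve ℚ) [W.IsElliptic] [W.IsGloballyMinimal] [W'.IsElliptic]
    [W'.IsGloballyMinimal] {d : ℤ} {C : WeierstrassCurve.VariableChange ℚ}
    (hC : C • W' = W.quadraticTwist (d : ℚ)) {N N' : ℕ} (hN : (N : ℤ) = W.conductorNorm ℤ)
    (hN' : (N' : ℤ) = W'.conductorNorm ℤ) {K : Type} [Field K] [NumberField K]
    (hHeeg : ∀ ℓ : ℕ, ℓ.Prime → ℓ ∣ N →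
      ((Ideal.span {(ℓ : ℤ)}).primesOver (NumberField.RingOfIntegers K)).ncard = 2)
    (hd : ∀ ℓ : ℕ, ℓ.Prime → (ℓ : ℤ) ∣ d →
      ((Ideal.span {(ℓ : ℤ)}).primesOver (NumberField.RingOfIntegers K)).ncard = 2)
    (h2 : ((Ideal.span {(2 : ℤ)}).primesOver (NumberField.RingOfIntegers K)).ncard = 2) :
    ∀ ℓ : ℕ, ℓ.Prime → ℓ ∣ N' →
      ((Ideal.span {(ℓ : ℤ)}).primesOver (NumberField.RingOfIntegers K)).ncard = 2 := by
  intro ℓ hℓ hℓN'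
  haveI : Fact ℓ.Prime := ⟨hℓ⟩
  have hN'n : N' = W'.conductorNorm ℤ := by exact_mod_cast hN'
  have hbad : ¬ W'.HasGoodReductionAtPrime ℓ :=
    (W'.dvd_conductorNorm_iff_not_hasGoodReductionAtPrime ℓ).mp (hN'n ▸ hℓN')
  by_cases hr : RamifiedInQuadratic d ℓ
  · rcases hr with hdvd | ⟨h2ℓ, -⟩
    · exact hd ℓ hℓ hdvd
    · subst h2ℓ
      simpa using h2
  · have hbadW : ¬ W.HasGoodReductionAtPrime ℓ := fun hg ↦ hbad
      (Summit.BirchSwinnertonDyer.BirchSwinnertonDyer.Theorems.SignedBaseChangeK2RFrames.hasGoodReductionAtPrime_of_smul_eq_quadraticTwist_of_not_ramifiedInQuadratic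
        W W' hC hℓ hg hr)
    have hNn : N = W.conductorNorm ℤ := by exact_mod_cast hN
    exact hHeeg ℓ hℓ (hNn ▸ (W.dvd_conductorNorm_iff_not_hasGoodReductionAtPrime ℓ).mpr hbadW)

/-! ## The composition: K1′ by name -/

/-- composition: FD⁺ (landed) supplies the package; per factor (ES) + (AC) + (UFD) + rigidity give the
integral inclusion `ch ⊆ (G)` (surjectivity for the twist: in-tree); the product clause of K1′ holds with `s = 1`. -/
theorem TwistPairGreenbergProductDivisibilitySplit_of :
    Summit.BirchSwinnertonDyer.BirchSwinnertonDyer.Theses.SignedBaseChange.TwistPairGreenbergProductDivisibilitySplit := by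
  intro hmodP W _ _ p _ hp hX hs
  obtain ⟨K, iF, iNF, ι, v, vbar, κ₁, κ₂, γ₁, γ₂, iPair, iD, N, iN, f, d, W', iE', iM', C, N', iN', f',
      h0, h1, h2, h3, h4, h5, h6, h7, h8, h9, h10, h11, h12, h13, h14, h15, h16, h17,
      e1, e2, e3, e4, e5, e6, e7⟩ :=
    Summit.BirchSwinnertonDyer.BirchSwinnertonDyer.Theorems.SignedBaseChangeK1FrameDataBCSSplit.stub_frameDataBCSsplit
      hmodP W p hp hX hs
  -- per-factor hypotheses for `W` and for the twist `W'`
  have hgood : W.HasGoodReductionAtPrime p := hX.1.1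
  have hgood' : W'.HasGoodReductionAtPrime p :=
    Summit.BirchSwinnertonDyer.BirchSwinnertonDyer.Theorems.SignedBaseChangeK2RFrames.hasGoodReductionAtPrime_of_smul_eq_quadraticTwist_of_not_ramifiedInQuadratic
      W W' h7 Fact.out hgood (fun hr ↦ (h6 p Fact.out hr).1 rfl)
  have hs' : Literature.NumberTheory.EllipticCurves.Rank1Residual.Surj W' p :=
    surj_of_smul_eq_quadraticTwist W W' p h5 h7 hs
  have h14' : IsCoprime (N' : ℤ) (NumberField.discr K) :=
    Summit.BirchSwinnertonDyer.BirchSwinnertonDyer.Theorems.SignedBaseChangeK2RFrames.isCoprime_conductorNorm_twist_discr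
      W W' h7 h1 h3 (fun q hq hr ↦ ⟨(h6 q hq hr).2.1, (h6 q hq hr).2.2⟩) h14
  have e1' := heegner_twist W W' h7 h1 h3 (K := K) e1 e5 e2
  refine ⟨K, iF, iNF, ι, v, vbar, κ₁, κ₂, γ₁, γ₂, iPair, iD, N, iN, f, d, W', iE', iM', C, N', iN', f',
    h0, h1, h2, h3, h4, h5, h6, h7, h8, h9, h10, h11, h12, h13, h14, e1, e5, e2, h15, h16, h17, ?_⟩
  intro Ω δ Ωp LK G G' hΩ hδ hLK hG hG' J hJ
  have hA : (WeierstrassCurve.XGr₂.charIdeal (W.baseChange K) p κ₁ κ₂ vbar γ₁ γ₂).map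
      (IwasawaAlgebra₂.toUnr₂ p J) ≤ Ideal.span {G} :=
    map_le_span_of_anchor (charIdealIsPrincipal₂ p _) J
      (stub_eulerSystemDivisibility hmodP W p hp hgood hs K ι v vbar κ₁ κ₂ γ₁ γ₂ N f h0 h1 h8 h9 h10
        h11 h12 h13 h14 e1 e3.1 e3.2 h16 h17 Ω δ Ωp LK G hΩ hδ hLK hG J hJ)
      (stub_anticyclotomicAnchor hmodP W p hp hgood hs K ι v vbar κ₁ κ₂ γ₁ γ₂ N f h0 h1 h8 h9 h10
        h11 h12 h13 h14 e1 e3.1 e3.2 h16 h17 Ω δ Ωp LK G hΩ hδ hLK hG J hJ)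
  have hB : (WeierstrassCurve.XGr₂.charIdeal (W'.baseChange K) p κ₁ κ₂ vbar γ₁ γ₂).map
      (IwasawaAlgebra₂.toUnr₂ p J) ≤ Ideal.span {G'} :=
    map_le_span_of_anchor (charIdealIsPrincipal₂ p _) J
      (stub_eulerSystemDivisibility hmodP W' p hp hgood' hs' K ι v vbar κ₁ κ₂ γ₁ γ₂ N' f' h2 h3 h8 h9
        h10 h11 h12 h13 h14' e1' e3.1 e3.2 h16 h17 Ω δ Ωp LK G' hΩ hδ hLK hG' J hJ)
      (stub_anticyclotomicAnchor hmodP W' p hp hgood' hs' K ι v vbar κ₁ κ₂ γ₁ γ₂ N' f' h2 h3 h8 h9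
        h10 h11 h12 h13 h14' e1' e3.1 e3.2 h16 h17 Ω δ Ωp LK G' hΩ hδ hLK hG' J hJ)
  exact ⟨1, one_ne_zero, span_C_one_mul_mul_le hA hB⟩

end Summit.BirchSwinnertonDyer.BirchSwinnertonDyer.Cruxes.TwistPairGreenbergProductDivisibilitySplit.Acanchor
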